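import Summits.QuantumFields.QCD.Theorems.SpectralDefectExtinctionWegnerEstimateSketchDefs
import Summits.QuantumFields.QCD.Theorems.SpectralDefectExtinctionWegnerEstimateStubDiracLocality
import Summits.QuantumFields.QCD.Theorems.SpectralDefectExtinctionWegnerEstimateStubEnvContinuous

/-!
# Crux `WegnerEstimate` (item stmt-QuantumFields-8966), line `Sketch` gen 4: LOCALITY of `badStar` / `badEnv`
(the exterior is immaterial)

`badStar R R' w` (interior-normalised min-functional, `…SketchDefs` gen 4) reads the link datum `w` at the links based
in the cube `box 4 R` (the CELL links: every current, every forward hop, every backward hop from inside the cube) and,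
through the backward hops at the lower faces, ALSO at the exterior links `(y − μ̂, μ)` with `y μ = −R` — but the value
does not depend on the latter when `R' ≤ R`: the outer site `z = y − μ̂` (exactly one coordinate `= −(R+1)`) is read by
that one hop only, is not an endpoint of any cell link and carries no interior mass, so the colour rotation
`φ(z) ↦ w(z,μ) w'(z,μ)⁻¹ φ(z)` of the competitor fields matches the objective of `w` with that of any `w'` agreeing with
`w` on the cell links (`badStar_congr_cell`).  Consequences: `badStar R R'` and the envelope `badEnv R R'` of the glued
configuration `glue_{x,R}(U, V)` read around `x` do not depend on the exterior `U` (`badStar_glue_indep`,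
`badEnv_glue_indep`) — the small-ball stubs `stub_envSmallBallLarge/Small` are statements about the cell links alone.
Written by the line lead (prover-line-stmt-QuantumFields-8966-c4-0).
-/

noncomputable section

namespace Summit.QuantumFields.QCD.Cruxes.WegnerEstimate.ResolventCell

open scoped BigOperators Matrix
open Literature.MathematicalPhysics.QuantumLattice Literature.MathematicalPhysics.QuantumFieldTheory
  Literature.Probability.LatticeModels
open Matrix

/-! ### Geometry of the lower outer layer -/

/-- A site of `box 4 R` has no coordinate equal to `−(R+1)`. -/
theorem badStarLocality_ne_low_of_mem_box {R : ℕ} {y : Fin 4 → ℤ} (hy : y ∈ box 4 R) (ν : Fin 4) :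
    y ν ≠ -((R : ℤ) + 1) := by
  rw [mem_box] at hy
  have := (hy ν).1
  omega

/-- The forward neighbour of a site of `box 4 R` has no coordinate equal to `−(R+1)`. -/
theorem badStarLocality_ne_low_add {R : ℕ} {y : Fin 4 → ℤ} (hy : y ∈ box 4 R) (μ ν : Fin 4) :
    (y + Pi.single μ 1 : Fin 4 → ℤ) ν ≠ -((R : ℤ) + 1) := by
  rw [mem_box] at hy
  have h := (hy ν).1
  simp only [Pi.add_apply]
  by_cases hνμ : ν = μ
  · subst hνμ; simp; omega
  · rw [Pi.single_eq_of_ne hνμ]; omega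

/-- The backward neighbour in direction `μ` of a site with `y μ ≠ −R` stays in the cube. -/
theorem badStarLocality_sub_mem_box {R : ℕ} {y : Fin 4 → ℤ} (hy : y ∈ box 4 R) {μ : Fin 4} (hμ : y μ ≠ -(R : ℤ)) :
    y - Pi.single μ 1 ∈ box 4 R := by
  rw [mem_box] at hy ⊢
  intro i
  simp only [Pi.sub_apply]
  by_cases hiμ : i = μ
  · subst hiμ
    have h := hy i
    simp
    omega
  · rw [Pi.single_eq_of_ne hiμ]
    simpa using hy i

/-- At a lower face (`y μ = −R`) the backward neighbour `z = y − μ̂` has `z ν = −(R+1)` exactly for `ν = μ`. -/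
theorem badStarLocality_sub_low_iff {R : ℕ} {y : Fin 4 → ℤ} (hy : y ∈ box 4 R) {μ : Fin 4} (hμ : y μ = -(R : ℤ))
    (ν : Fin 4) : (y - Pi.single μ 1 : Fin 4 → ℤ) ν = -((R : ℤ) + 1) ↔ ν = μ := by
  rw [mem_box] at hy
  simp only [Pi.sub_apply]
  constructor
  · intro h
    by_contra hνμ
    rw [Pi.single_eq_of_ne hνμ] at h
    have := (hy ν).1
    omega
  · rintro rfl
    simp [hμ]
    ring

/-! ### The colour rotation of the lower outer layer -/

/-- The rotation assigned to an outer site: `w(z, μ) · w'(z, μ)⁻¹` for the (unique) direction `μ` with `z μ = −(R+1)`,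
`1` elsewhere (irrelevant there). -/
theorem badStarLocality_rot_spec {R : ℕ} (w w' : LinkData) {z : Fin 4 → ℤ} {μ : Fin 4}
    (huniq : ∀ ν : Fin 4, z ν = -((R : ℤ) + 1) ↔ ν = μ) :
    (if h : ∃ ν : Fin 4, z ν = -((R : ℤ) + 1) then w (z, Classical.choose h) * (w' (z, Classical.choose h))⁻¹
      else (1 : SU3)) = w (z, μ) * (w' (z, μ))⁻¹ := by
  have hex : ∃ ν : Fin 4, z ν = -((R : ℤ) + 1) := ⟨μ, (huniq μ).2 rfl⟩
  rw [dif_pos hex]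
  have hc : Classical.choose hex = μ := (huniq _).1 (Classical.choose_spec hex)
  rw [hc]

/-- Pure algebra of the backward hop through a rotated outer value:
`Σ_b Σ_β B_{αβ} M_{ab} (Σ_c G_{bc} v_{cβ}) = Σ_b Σ_β B_{αβ} (M G)_{ab} v_{bβ}`. -/
theorem badStarLocality_sum_rotate (B : Matrix (Fin 4) (Fin 4) ℂ) (M G : Matrix (Fin 3) (Fin 3) ℂ)
    (v : Fin 3 → Fin 4 → ℂ) (α : Fin 4) (a : Fin 3) :
    ∑ b : Fin 3, ∑ β : Fin 4, B α β * M a b * (∑ c : Fin 3, G b c * v c β) =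
      ∑ b : Fin 3, ∑ β : Fin 4, B α β * (M * G) a b * v b β := by
  have hL : (∑ b : Fin 3, ∑ β : Fin 4, B α β * M a b * (∑ c : Fin 3, G b c * v c β)) =
      ∑ b : Fin 3, ∑ β : Fin 4, ∑ c : Fin 3, B α β * M a b * (G b c * v c β) := by
    simp only [Finset.mul_sum]
  have hR : (∑ b : Fin 3, ∑ β : Fin 4, B α β * (M * G) a b * v b β) =
      ∑ b : Fin 3, ∑ β : Fin 4, ∑ c : Fin 3, B α β * (M a c * G c b) * v b β := by
    simp only [Matrix.mul_apply, Finset.sum_mul, Finset.mul_sum]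
  rw [hL, hR]
  calc (∑ b : Fin 3, ∑ β : Fin 4, ∑ c : Fin 3, B α β * M a b * (G b c * v c β))
      = ∑ b : Fin 3, ∑ c : Fin 3, ∑ β : Fin 4, B α β * M a b * (G b c * v c β) :=
        Finset.sum_congr rfl fun b _ => Finset.sum_comm
    _ = ∑ c : Fin 3, ∑ b : Fin 3, ∑ β : Fin 4, B α β * M a b * (G b c * v c β) := Finset.sum_comm
    _ = ∑ c : Fin 3, ∑ β : Fin 4, ∑ b : Fin 3, B α β * M a b * (G b c * v c β) :=
        Finset.sum_congr rfl fun c _ => Finset.sum_comm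
    _ = ∑ b : Fin 3, ∑ β : Fin 4, ∑ c : Fin 3, B α β * (M a c * G c b) * v b β :=
        Finset.sum_congr rfl fun c _ => Finset.sum_congr rfl fun β _ => Finset.sum_congr rfl fun b _ => by ring

/-! ### The rotated competitor field and its zero extension -/

/-- Zero extension of the rotated field at a site WITHOUT a coordinate `−(R+1)`: unchanged. -/
theorem badStarLocality_ballVal_rot_of_not {R : ℕ} (g : (Fin 4 → ℤ) → SU3) (ψ : BallField R) {u : Fin 4 → ℤ}
    (hu : ¬ ∃ ν : Fin 4, u ν = -((R : ℤ) + 1)) (a : Fin 3) (α : Fin 4) :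
    ballVal (fun p : ↥(box 4 (R + 1)) × Fin 3 × Fin 4 =>
        if (∃ ν : Fin 4, (p.1 : Fin 4 → ℤ) ν = -((R : ℤ) + 1)) then
          ∑ c : Fin 3, ((g (p.1 : Fin 4 → ℤ) : SU3) : Matrix (Fin 3) (Fin 3) ℂ) p.2.1 c * ψ (p.1, c, p.2.2)
        else ψ p) u a α = ballVal ψ u a α := by
  unfold ballVal
  split_ifs with h
  · simp only [if_neg hu]
  · rfl

/-- Zero extension of the rotated field at a site WITH a coordinate `−(R+1)`: rotated by `g u`. -/
theorem badStarLocality_ballVal_rot_of {R : ℕ} (g : (Fin 4 → ℤ) → SU3) (ψ : BallField R) {u : Fin 4 → ℤ}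
    (hu : ∃ ν : Fin 4, u ν = -((R : ℤ) + 1)) (a : Fin 3) (α : Fin 4) :
    ballVal (fun p : ↥(box 4 (R + 1)) × Fin 3 × Fin 4 =>
        if (∃ ν : Fin 4, (p.1 : Fin 4 → ℤ) ν = -((R : ℤ) + 1)) then
          ∑ c : Fin 3, ((g (p.1 : Fin 4 → ℤ) : SU3) : Matrix (Fin 3) (Fin 3) ℂ) p.2.1 c * ψ (p.1, c, p.2.2)
        else ψ p) u a α = ∑ c : Fin 3, ((g u : SU3) : Matrix (Fin 3) (Fin 3) ℂ) a c * ballVal ψ u c α := by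
  unfold ballVal
  split_ifs with h
  · simp only [if_pos hu]
  · simp

/-- Interior mass of the rotated field: unchanged (`R' ≤ R`: no site of `box 4 R'` has a coordinate `−(R+1)`). -/
theorem badStarLocality_ballBoxMass_rot {R R' : ℕ} (hR' : R' ≤ R) (g : (Fin 4 → ℤ) → SU3) (ψ : BallField R) :
    ballBoxMass R R' (fun p : ↥(box 4 (R + 1)) × Fin 3 × Fin 4 =>
        if (∃ ν : Fin 4, (p.1 : Fin 4 → ℤ) ν = -((R : ℤ) + 1)) then
          ∑ c : Fin 3, ((g (p.1 : Fin 4 → ℤ) : SU3) : Matrix (Fin 3) (Fin 3) ℂ) p.2.1 c * ψ (p.1, c, p.2.2)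
        else ψ p) = ballBoxMass R R' ψ := by
  unfold ballBoxMass
  refine Finset.sum_congr rfl fun y hy => Finset.sum_congr rfl fun a _ => Finset.sum_congr rfl fun α _ => ?_
  have hu : ¬ ∃ ν : Fin 4, y ν = -((R : ℤ) + 1) := fun ⟨ν, hν⟩ =>
    badStarLocality_ne_low_of_mem_box (box_mono 4 hR' hy) ν hν
  rw [badStarLocality_ballVal_rot_of_not g ψ hu]

/-- Cube currents of the rotated field: unchanged (a cell link has no endpoint with a coordinate `−(R+1)`). -/
theorem badStarLocality_ballCurrent_rot {R : ℕ} (w : LinkData) (g : (Fin 4 → ℤ) → SU3) (ψ : BallField R)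
    {y : Fin 4 → ℤ} (hy : y ∈ box 4 R) (μ : Fin 4) (i : Fin 8) :
    ballCurrent w (fun p : ↥(box 4 (R + 1)) × Fin 3 × Fin 4 =>
        if (∃ ν : Fin 4, (p.1 : Fin 4 → ℤ) ν = -((R : ℤ) + 1)) then
          ∑ c : Fin 3, ((g (p.1 : Fin 4 → ℤ) : SU3) : Matrix (Fin 3) (Fin 3) ℂ) p.2.1 c * ψ (p.1, c, p.2.2)
        else ψ p) y μ i = ballCurrent w ψ y μ i := by
  have h1 : ¬ ∃ ν : Fin 4, y ν = -((R : ℤ) + 1) := fun ⟨ν, hν⟩ => badStarLocality_ne_low_of_mem_box hy ν hν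
  have h2 : ¬ ∃ ν : Fin 4, (y + Pi.single μ 1 : Fin 4 → ℤ) ν = -((R : ℤ) + 1) := fun ⟨ν, hν⟩ =>
    badStarLocality_ne_low_add hy μ ν hν
  simp only [ballCurrent, badStarLocality_ballVal_rot_of_not g ψ h1, badStarLocality_ballVal_rot_of_not g ψ h2]

/-- **The key identity.**  If `w` and `w'` agree on the cell links and the rotation `g` satisfies
`w(z,μ)⁻¹ g(z) = w'(z,μ)⁻¹` at every lower outer site `z = y − μ̂` (`y μ = −R`), then the Wilson–Dirac image of the
rotated field under `w` equals that of the original field under `w'`, at every site of the cube. -/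
theorem badStarLocality_ballApply_rot {R : ℕ} (m₀ : ℝ) {w w' : LinkData}
    (hw : ∀ y ∈ box 4 R, ∀ μ : Fin 4, w (y, μ) = w' (y, μ)) (g : (Fin 4 → ℤ) → SU3)
    (hg : ∀ y ∈ box 4 R, ∀ μ : Fin 4, y μ = -(R : ℤ) →
      (w (y - Pi.single μ 1, μ))⁻¹ * g (y - Pi.single μ 1) = (w' (y - Pi.single μ 1, μ))⁻¹)
    (ψ : BallField R) {y : Fin 4 → ℤ} (hy : y ∈ box 4 R) (a : Fin 3) (α : Fin 4) :
    ballApply m₀ w (fun p : ↥(box 4 (R + 1)) × Fin 3 × Fin 4 =>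
        if (∃ ν : Fin 4, (p.1 : Fin 4 → ℤ) ν = -((R : ℤ) + 1)) then
          ∑ c : Fin 3, ((g (p.1 : Fin 4 → ℤ) : SU3) : Matrix (Fin 3) (Fin 3) ℂ) p.2.1 c * ψ (p.1, c, p.2.2)
        else ψ p) y a α = ballApply m₀ w' ψ y a α := by
  have h1 : ¬ ∃ ν : Fin 4, y ν = -((R : ℤ) + 1) := fun ⟨ν, hν⟩ => badStarLocality_ne_low_of_mem_box hy ν hν
  unfold ballApply
  congr 1
  · simp only [badStarLocality_ballVal_rot_of_not g ψ h1]
  · refine Finset.sum_congr rfl fun μ _ => ?_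
    have h2 : ¬ ∃ ν : Fin 4, (y + Pi.single μ 1 : Fin 4 → ℤ) ν = -((R : ℤ) + 1) := fun ⟨ν, hν⟩ =>
      badStarLocality_ne_low_add hy μ ν hν
    simp only [Finset.sum_add_distrib, badStarLocality_ballVal_rot_of_not g ψ h2, hw y hy μ]
    congr 1
    by_cases hμ : y μ = -(R : ℤ)
    · -- lower face: the outer value is rotated and the rotation is absorbed by the exterior link
      have hex : ∃ ν : Fin 4, (y - Pi.single μ 1 : Fin 4 → ℤ) ν = -((R : ℤ) + 1) :=
        ⟨μ, (badStarLocality_sub_low_iff hy hμ μ).2 rfl⟩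
      simp only [badStarLocality_ballVal_rot_of g ψ hex]
      rw [badStarLocality_sum_rotate]
      have hmat : (((w (y - Pi.single μ 1, μ))⁻¹ : SU3) : Matrix (Fin 3) (Fin 3) ℂ) *
          ((g (y - Pi.single μ 1) : SU3) : Matrix (Fin 3) (Fin 3) ℂ) =
          (((w' (y - Pi.single μ 1, μ))⁻¹ : SU3) : Matrix (Fin 3) (Fin 3) ℂ) := by
        rw [← hg y hy μ hμ]
        rfl
      rw [hmat]
    · -- interior in direction μ: the backward link is a cell link, the value is unchanged
      have hz : y - Pi.single μ 1 ∈ box 4 R := badStarLocality_sub_mem_box hy hμ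
      have h3 : ¬ ∃ ν : Fin 4, (y - Pi.single μ 1 : Fin 4 → ℤ) ν = -((R : ℤ) + 1) := fun ⟨ν, hν⟩ =>
        badStarLocality_ne_low_of_mem_box hz ν hν
      simp only [badStarLocality_ballVal_rot_of_not g ψ h3, hw _ hz μ]

/-! ### The objective of the rotated field -/

/-- Cube current sum under cell agreement of the link data (same field). -/
theorem badStarLocality_currentSum_congr_cell {R : ℕ} {w w' : LinkData}
    (hw : ∀ y ∈ box 4 R, ∀ μ : Fin 4, w (y, μ) = w' (y, μ)) (φ : BallField R) :
    currentSum R w φ = currentSum R w' φ := by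
  unfold currentSum
  refine Finset.sum_congr rfl fun y hy => Finset.sum_congr rfl fun μ _ => Finset.sum_congr rfl fun i _ => ?_
  simp only [ballCurrent, hw y hy μ]

/-- Cube current sum of the rotated field: unchanged. -/
theorem badStarLocality_currentSum_rot {R : ℕ} (w : LinkData) (g : (Fin 4 → ℤ) → SU3) (ψ : BallField R) :
    currentSum R w (fun p : ↥(box 4 (R + 1)) × Fin 3 × Fin 4 =>
        if (∃ ν : Fin 4, (p.1 : Fin 4 → ℤ) ν = -((R : ℤ) + 1)) then
          ∑ c : Fin 3, ((g (p.1 : Fin 4 → ℤ) : SU3) : Matrix (Fin 3) (Fin 3) ℂ) p.2.1 c * ψ (p.1, c, p.2.2)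
        else ψ p) = currentSum R w ψ := by
  unfold currentSum
  exact Finset.sum_congr rfl fun y hy => Finset.sum_congr rfl fun μ _ => Finset.sum_congr rfl fun i _ =>
    congrArg _ (badStarLocality_ballCurrent_rot w g ψ hy μ i)

/-- Cube residual of the rotated field under `w` = cube residual of the original field under `w'`. -/
theorem badStarLocality_residualSq_rot {R : ℕ} (m₀ lam : ℝ) {w w' : LinkData}
    (hw : ∀ y ∈ box 4 R, ∀ μ : Fin 4, w (y, μ) = w' (y, μ)) (g : (Fin 4 → ℤ) → SU3)
    (hg : ∀ y ∈ box 4 R, ∀ μ : Fin 4, y μ = -(R : ℤ) →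
      (w (y - Pi.single μ 1, μ))⁻¹ * g (y - Pi.single μ 1) = (w' (y - Pi.single μ 1, μ))⁻¹)
    (ψ : BallField R) :
    residualSq R m₀ lam w (fun p : ↥(box 4 (R + 1)) × Fin 3 × Fin 4 =>
        if (∃ ν : Fin 4, (p.1 : Fin 4 → ℤ) ν = -((R : ℤ) + 1)) then
          ∑ c : Fin 3, ((g (p.1 : Fin 4 → ℤ) : SU3) : Matrix (Fin 3) (Fin 3) ℂ) p.2.1 c * ψ (p.1, c, p.2.2)
        else ψ p) = residualSq R m₀ lam w' ψ := by
  unfold residualSq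
  refine Finset.sum_congr rfl fun y hy => Finset.sum_congr rfl fun a _ => Finset.sum_congr rfl fun α _ => ?_
  have h1 : ¬ ∃ ν : Fin 4, y ν = -((R : ℤ) + 1) := fun ⟨ν, hν⟩ => badStarLocality_ne_low_of_mem_box hy ν hν
  rw [badStarLocality_ballApply_rot m₀ hw g hg ψ hy, badStarLocality_ballVal_rot_of_not g ψ h1]

/-! ### Nonemptiness of the competitor set -/

/-- Zero extension of a rescaled field. -/
theorem badStarLocality_ballVal_smul {R : ℕ} (c : ℂ) (φ : BallField R) (u : Fin 4 → ℤ) (a : Fin 3) (α : Fin 4) :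
    ballVal (fun p => c * φ p) u a α = c * ballVal φ u a α := by
  unfold ballVal
  split_ifs
  · rfl
  · rw [mul_zero]

/-- **A ball field of interior mass one exists** (normalise the constant field: the centre contributes). -/
theorem badStarLocality_exists_ballBoxMass_eq_one (R R' : ℕ) : ∃ φ : BallField R, ballBoxMass R R' φ = 1 := by
  set s : ℝ := ballBoxMass R R' (fun _ => 1) with hs
  have h0 : (0 : Fin 4 → ℤ) ∈ box 4 R' := by
    rw [mem_box]; intro i; simp
  have h0' : (0 : Fin 4 → ℤ) ∈ box 4 (R + 1) := by
    rw [mem_box]; intro i; simp; positivity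
  have hterm : (1 : ℝ) ≤ ∑ a : Fin 3, ∑ α : Fin 4, ‖ballVal (fun _ : ↥(box 4 (R + 1)) × Fin 3 × Fin 4 => (1 : ℂ))
      (0 : Fin 4 → ℤ) a α‖ ^ 2 := by
    have hv : ∀ a α, ballVal (fun _ : ↥(box 4 (R + 1)) × Fin 3 × Fin 4 => (1 : ℂ)) (0 : Fin 4 → ℤ) a α = 1 := by
      intro a α; unfold ballVal; rw [dif_pos h0']
    simp only [hv, norm_one, one_pow, Finset.sum_const, Finset.card_univ, Fintype.card_fin]
    norm_num
  have hspos : 0 < s := by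
    have hle : ∑ a : Fin 3, ∑ α : Fin 4, ‖ballVal (fun _ : ↥(box 4 (R + 1)) × Fin 3 × Fin 4 => (1 : ℂ))
        (0 : Fin 4 → ℤ) a α‖ ^ 2 ≤ s :=
      Finset.single_le_sum (f := fun y => ∑ a : Fin 3, ∑ α : Fin 4,
          ‖ballVal (fun _ : ↥(box 4 (R + 1)) × Fin 3 × Fin 4 => (1 : ℂ)) y a α‖ ^ 2)
        (fun _ _ => Finset.sum_nonneg fun _ _ => Finset.sum_nonneg fun _ _ => by positivity) h0
    linarith
  set c : ℝ := (Real.sqrt s)⁻¹ with hc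
  have hcs : c ^ 2 * s = 1 := by
    rw [hc, inv_pow, Real.sq_sqrt hspos.le, inv_mul_cancel₀ hspos.ne']
  refine ⟨fun _ => (c : ℂ), ?_⟩
  have hval : ∀ u a α, ballVal (fun _ : ↥(box 4 (R + 1)) × Fin 3 × Fin 4 => (c : ℂ)) u a α =
      (c : ℂ) * ballVal (fun _ : ↥(box 4 (R + 1)) × Fin 3 × Fin 4 => (1 : ℂ)) u a α := by
    intro u a α
    rw [← badStarLocality_ballVal_smul]
    simp
  calc ballBoxMass R R' (fun _ => (c : ℂ))
      = c ^ 2 * s := by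
        rw [hs, ballBoxMass, ballBoxMass, Finset.mul_sum]
        refine Finset.sum_congr rfl fun y _ => ?_
        rw [Finset.mul_sum]
        refine Finset.sum_congr rfl fun a _ => ?_
        rw [Finset.mul_sum]
        refine Finset.sum_congr rfl fun α _ => ?_
        rw [hval, norm_mul, mul_pow, Complex.norm_real, Real.norm_eq_abs, sq_abs]
    _ = 1 := hcs

/-! ### Locality of `badStar` -/

/-- **Locality of the interior-normalised min-functional**: for `R' ≤ R`, `badStar R R'` depends on the link datum only
through the CELL links (the links based in `box 4 R`); in particular not on the exterior links entering the lower faces. -/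
theorem badStar_congr_cell {R R' : ℕ} (hR' : R' ≤ R) {w w' : LinkData}
    (hw : ∀ y ∈ box 4 R, ∀ μ : Fin 4, w (y, μ) = w' (y, μ)) : badStar R R' w = badStar R R' w' := by
  suffices key : ∀ w w' : LinkData, (∀ y ∈ box 4 R, ∀ μ : Fin 4, w (y, μ) = w' (y, μ)) →
      badStar R R' w ≤ badStar R R' w' from
    le_antisymm (key w w' hw) (key w' w fun y hy μ => (hw y hy μ).symm)
  intro w w' hw
  unfold badStar
  refine csInf_le_csInf ⟨0, ?_⟩ ?_ ?_
  · rintro r ⟨m₀, lam, φ, -, -, -, -, rfl⟩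
    exact add_nonneg (currentSum_nonneg R w φ) (residualSq_nonneg R m₀ lam w φ)
  · obtain ⟨φ, hφ⟩ := badStarLocality_exists_ballBoxMass_eq_one R R'
    exact ⟨_, 0, 0, φ, by norm_num, le_rfl, by norm_num, hφ, rfl⟩
  · rintro r ⟨m₀, lam, ψ, h1, h2, h3, h4, rfl⟩
    -- the rotation of the lower outer layer that trades `w'` for `w`
    let g : (Fin 4 → ℤ) → SU3 := fun z =>
      if h : ∃ ν : Fin 4, z ν = -((R : ℤ) + 1) then w (z, Classical.choose h) * (w' (z, Classical.choose h))⁻¹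
      else 1
    have hg : ∀ y ∈ box 4 R, ∀ μ : Fin 4, y μ = -(R : ℤ) →
        (w (y - Pi.single μ 1, μ))⁻¹ * g (y - Pi.single μ 1) = (w' (y - Pi.single μ 1, μ))⁻¹ := by
      intro y hy μ hμ
      have hrot := badStarLocality_rot_spec w w' (badStarLocality_sub_low_iff hy hμ)
      show (w (y - Pi.single μ 1, μ))⁻¹ *
          (if h : ∃ ν : Fin 4, (y - Pi.single μ 1 : Fin 4 → ℤ) ν = -((R : ℤ) + 1) then
            w (y - Pi.single μ 1, Classical.choose h) * (w' (y - Pi.single μ 1, Classical.choose h))⁻¹ else 1) = _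
      rw [hrot, inv_mul_cancel_left]
    refine ⟨m₀, lam, (fun p : ↥(box 4 (R + 1)) × Fin 3 × Fin 4 =>
        if (∃ ν : Fin 4, (p.1 : Fin 4 → ℤ) ν = -((R : ℤ) + 1)) then
          ∑ c : Fin 3, ((g (p.1 : Fin 4 → ℤ) : SU3) : Matrix (Fin 3) (Fin 3) ℂ) p.2.1 c * ψ (p.1, c, p.2.2)
        else ψ p), h1, h2, h3, ?_, ?_⟩
    · rw [badStarLocality_ballBoxMass_rot hR' g ψ]; exact h4
    · rw [badStarLocality_currentSum_rot, badStarLocality_currentSum_congr_cell hw,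
        badStarLocality_residualSq_rot m₀ lam hw g hg ψ]

/-- **The exterior is immaterial for `badStar`**: read around `x`, glued configurations with the same cell links give the
same value; in particular `badStar R R'` of `glue_{x,R}(U, V)` does not depend on `U` (`R' ≤ R`). -/
theorem badStar_glue_indep {R R' : ℕ} (hR' : R' ≤ R) {L : ℕ} [NeZero L] (x : TorusSite 4 L)
    (U U' V : GaugeConfig 4 L SU3) :
    badStar R R' (fun l => (fun e : Edge 4 L => if (∃ y ∈ box 4 R, e.1 = x + Torus.proj L y) then V e else U e)
        (x + Torus.proj L l.1, l.2)) =
      badStar R R' (fun l => (fun e : Edge 4 L => if (∃ y ∈ box 4 R, e.1 = x + Torus.proj L y) then V e else U' e)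
        (x + Torus.proj L l.1, l.2)) := by
  refine badStar_congr_cell hR' fun y hy μ => ?_
  have h : ∃ y' ∈ box 4 R, x + Torus.proj L y = x + Torus.proj L y' := ⟨y, hy, rfl⟩
  simp only [if_pos h]

/-! ### Locality of the envelope `badEnv` -/

/-- Link cost restricted to the cell links is dominated by the full link cost, and equals the link cost of a datum
modified only on the cell. -/
theorem badStarLocality_linkCost_splice_le {R : ℕ} (w₁ w₂ u : LinkData)
    (hw : ∀ y ∈ box 4 R, ∀ μ : Fin 4, w₁ (y, μ) = w₂ (y, μ)) :
    linkCost R w₁ (fun l => if l.1 ∈ box 4 R then u l else w₁ l) ≤ linkCost R w₂ u := by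
  unfold linkCost
  refine Finset.sum_le_sum fun y _ => Finset.sum_le_sum fun μ _ => Finset.sum_le_sum fun a _ =>
    Finset.sum_le_sum fun b _ => ?_
  by_cases hy : y ∈ box 4 R
  · simp only [if_pos hy, hw y hy μ]; exact le_rfl
  · simp only [if_neg hy, sub_self, norm_zero]; exact norm_nonneg _

/-- **Locality of the envelope**: for `R' ≤ R`, `badEnv R R'` depends on the link datum only through the cell links. -/
theorem badEnv_congr_cell {R R' : ℕ} (hR' : R' ≤ R) {w₁ w₂ : LinkData}
    (hw : ∀ y ∈ box 4 R, ∀ μ : Fin 4, w₁ (y, μ) = w₂ (y, μ)) : badEnv R R' w₁ = badEnv R R' w₂ := by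
  suffices key : ∀ w₁ w₂ : LinkData, (∀ y ∈ box 4 R, ∀ μ : Fin 4, w₁ (y, μ) = w₂ (y, μ)) →
      badEnv R R' w₁ ≤ badEnv R R' w₂ from
    le_antisymm (key w₁ w₂ hw) (key w₂ w₁ fun y hy μ => (hw y hy μ).symm)
  intro w₁ w₂ hw
  rw [badEnv, badEnv]
  refine le_csInf (envContinuous_set_nonempty R R' w₂) ?_
  rintro r ⟨u, rfl⟩
  -- splice: cell links from `u`, everything else from `w₁`
  set u' : LinkData := fun l => if l.1 ∈ box 4 R then u l else w₁ l with hu'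
  have hstar : badStar R R' u' = badStar R R' u :=
    badStar_congr_cell hR' fun y hy μ => by simp only [hu', if_pos hy]
  have hcost : linkCost R w₁ u' ≤ linkCost R w₂ u := badStarLocality_linkCost_splice_le w₁ w₂ u hw
  calc sInf {r : ℝ | ∃ w' : LinkData, r = badStar R R' w' + linkCost R w₁ w'}
      ≤ badStar R R' u' + linkCost R w₁ u' := csInf_le (envContinuous_set_bddBelow R R' w₁) ⟨u', rfl⟩
    _ ≤ badStar R R' u + linkCost R w₂ u := by rw [hstar]; linarith

/-- **The exterior is immaterial for the envelope**: `badEnv R R'` of `glue_{x,R}(U, V)` read around `x` does not depend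
on `U` (`R' ≤ R`) — the small-ball stubs of the line are statements about the cell links alone. -/
theorem badEnv_glue_indep {R R' : ℕ} (hR' : R' ≤ R) {L : ℕ} [NeZero L] (x : TorusSite 4 L)
    (U U' V : GaugeConfig 4 L SU3) :
    badEnv R R' (fun l => (fun e : Edge 4 L => if (∃ y ∈ box 4 R, e.1 = x + Torus.proj L y) then V e else U e)
        (x + Torus.proj L l.1, l.2)) =
      badEnv R R' (fun l => (fun e : Edge 4 L => if (∃ y ∈ box 4 R, e.1 = x + Torus.proj L y) then V e else U' e)
        (x + Torus.proj L l.1, l.2)) := by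
  refine badEnv_congr_cell hR' fun y hy μ => ?_
  have h : ∃ y' ∈ box 4 R, x + Torus.proj L y = x + Torus.proj L y' := ⟨y, hy, rfl⟩
  simp only [if_pos h]

end Summit.QuantumFields.QCD.Cruxes.WegnerEstimate.ResolventCell

end
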